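import Mathlib
import Literature.MathematicalPhysics.QuantumLattice.WilsonDiracAP
import Literature.Analysis.InnerProduct.SchurInequality
import Literature.Probability.LatticeModels.SlitPlaneAsymptotics

/-!
# Second-order bound for `log ‖det (1 + R)‖` under an operator bound
(helper for crux stmt-QuantumFields-9734, line `Sketch`, stub `stub_logDetSecondOrder`)

For a complex square matrix `R` on a finite index type `ι` with `Σᵢ ‖(R v)ᵢ‖² ≤ ρ² Σᵢ ‖vᵢ‖²`
for all `v` and `0 ≤ ρ ≤ 1/2`,

  `‖det (1 + R)‖ ≤ exp (Re tr R − ½ Re tr R² + 2 |ι| ρ³)`.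

Proof (eigenvalues over `ℂ` and Taylor bounds for the complex logarithm; no matrix logarithm).
Let `x` run over the roots of the characteristic polynomial of `R` and `y` over those of `R²`
(with multiplicity, `|ι|` of each).  Every root has an eigenvector
(`Literature.Analysis.InnerProduct.matrix_exists_mulVec_eq_smul_of_isRoot_charpoly`), so the
operator bound gives `‖x‖ ≤ ρ` and `‖y‖ ≤ ρ²` (`norm_root_charpoly_le`).  The characteristic
polynomial splits over `ℂ`, so `det (1 ± M) = Π (1 ± root)` and `tr M = Σ root`
(`Matrix.trace_eq_sum_roots_charpoly`, `Matrix.eval_charpoly`); hence, with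
`(1 + R)(1 − R) = 1 − R²`,

  `2 log ‖det (1 + R)‖ = Σ_y log ‖1 − y‖ + Σ_x (log ‖1 + x‖ − log ‖1 − x‖)`.

Root by root the even part is `≤ −Re y + ρ³` (`Complex.norm_log_one_add_sub_self_le`) and the
odd part is `≤ 2 Re x + 2 ρ³` (the quadratic Taylor terms cancel; cubic Taylor bound
`Literature.Probability.LatticeModels.norm_log_one_add_sub_le`, from Mathlib's
`Complex.norm_log_sub_logTaylor_le` with `logTaylor 3 z = z − z²/2`).  Summing and halving gives
`log ‖det (1 + R)‖ ≤ Re tr R − ½ Re tr R² + (3/2) |ι| ρ³`, and we exponentiate.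
Sources: Mathlib (`LinearAlgebra.Matrix.Charpoly.Eigs`,
`Analysis.SpecialFunctions.Complex.LogBounds`), the folklore companions of
`Literature/Analysis/InnerProduct/SchurInequality.lean`, and the cubic Taylor bound of
`Literature/Probability/LatticeModels/SlitPlaneAsymptotics.lean`.
No new definitions.
-/

noncomputable section

open scoped BigOperators Classical Matrix ComplexConjugate
open Finset
open Literature.MathematicalPhysics.QuantumLattice Literature.MathematicalPhysics.QuantumFieldTheory
  Literature.Probability.LatticeModels

namespace Summit.QuantumFields.QCD.Cruxes.CriticalLineDiamagnetism.ChessboardCellGain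

namespace LogDetSecondOrder

open Literature.Analysis.InnerProduct

variable {ι : Type*} [Fintype ι] [DecidableEq ι]

/-- **Eigenvalue bound from an operator bound**: if `Σᵢ ‖(M v)ᵢ‖² ≤ c² Σᵢ ‖vᵢ‖²` for all `v`
(`c ≥ 0`), then every root of the characteristic polynomial of `M` has modulus at most `c`
(apply the bound to an eigenvector of the root). -/
theorem norm_root_charpoly_le (M : Matrix ι ι ℂ) {c : ℝ} (hc : 0 ≤ c)
    (hM : ∀ v : ι → ℂ, ∑ i, ‖(M.mulVec v) i‖ ^ 2 ≤ c ^ 2 * ∑ i, ‖v i‖ ^ 2)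
    {x : ℂ} (hx : x ∈ M.charpoly.roots) : ‖x‖ ≤ c := by
  have hy : M.charpoly.IsRoot x := (Polynomial.mem_roots M.charpoly_monic.ne_zero).mp hx
  obtain ⟨u, hu, hMu⟩ := matrix_exists_mulVec_eq_smul_of_isRoot_charpoly M hy
  obtain ⟨i₀, hi₀⟩ := Function.ne_iff.mp hu
  have hpos : 0 < ∑ i, ‖u i‖ ^ 2 :=
    Finset.sum_pos' (fun i _ => sq_nonneg _)
      ⟨i₀, Finset.mem_univ _, pow_pos (norm_pos_iff.mpr hi₀) 2⟩
  have h := hM u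
  have h2 : ∑ i, ‖(M.mulVec u) i‖ ^ 2 = ‖x‖ ^ 2 * ∑ i, ‖u i‖ ^ 2 := by
    rw [Finset.mul_sum]
    refine Finset.sum_congr rfl fun i _ => ?_
    rw [hMu, Pi.smul_apply, smul_eq_mul, norm_mul, mul_pow]
  rw [h2] at h
  exact (sq_le_sq₀ (norm_nonneg _) hc).mp (le_of_mul_le_mul_right h hpos)

/-- The roots of the characteristic polynomial of a complex `ι × ι` matrix, counted with
multiplicity (as the multiset of roots coerced to a type), number `|ι|`. -/
theorem card_roots_charpoly (M : Matrix ι ι ℂ) :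
    Fintype.card M.charpoly.roots = Fintype.card ι := by
  rw [Multiset.card_coe, ← (IsAlgClosed.splits M.charpoly).natDegree_eq_card_roots,
    Matrix.charpoly_natDegree_eq_dim]

/-- `det (1 + M) = Π (1 + x)` over the roots `x` of the characteristic polynomial of `M`
(a finite product over the multiset of roots coerced to a type). -/
theorem det_one_add_eq_prod_coe (M : Matrix ι ι ℂ) :
    (1 + M).det = ∏ x : M.charpoly.roots, (1 + (x : ℂ)) := by
  rw [matrix_det_one_add_eq_prod_roots_charpoly, Finset.prod_eq_multiset_prod, Multiset.map_univ]

/-- `det (1 - M) = Π (1 - x)` over the roots `x` of the characteristic polynomial of `M`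
(the characteristic polynomial splits over `ℂ`; evaluate it at `1`). -/
theorem det_one_sub_eq_prod_coe (M : Matrix ι ι ℂ) :
    (1 - M).det = ∏ x : M.charpoly.roots, (1 - (x : ℂ)) := by
  have h1 : M.charpoly.eval 1 = (Matrix.scalar ι (1 : ℂ) - M).det := Matrix.eval_charpoly M 1
  rw [map_one, (IsAlgClosed.splits M.charpoly).eval_eq_prod_roots_of_monic M.charpoly_monic] at h1
  rw [← h1, Finset.prod_eq_multiset_prod, Multiset.map_univ]

/-- `Re tr M = Σ Re x` over the roots `x` of the characteristic polynomial of `M`. -/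
theorem trace_re_eq_sum_coe (M : Matrix ι ι ℂ) :
    M.trace.re = ∑ x : M.charpoly.roots, (x : ℂ).re := by
  rw [Matrix.trace_eq_sum_roots_charpoly, Multiset.sum_eq_sum_coe, Complex.re_sum]

/-- `1 + x` has positive modulus for `‖x‖ < 1`. -/
theorem norm_one_add_pos {x : ℂ} (hx : ‖x‖ < 1) : 0 < ‖1 + x‖ := by
  have h := norm_le_add_norm_add (1 : ℂ) x
  rw [norm_one] at h
  linarith

/-- `1 - x` has positive modulus for `‖x‖ < 1`. -/
theorem norm_one_sub_pos {x : ℂ} (hx : ‖x‖ < 1) : 0 < ‖1 - x‖ := by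
  have h := norm_one_add_pos (x := -x) (by rwa [norm_neg])
  rwa [← sub_eq_add_neg] at h

/-- **Even part, root by root**: for `‖y‖ ≤ ρ²` with `0 ≤ ρ ≤ 1/2`,
`log ‖1 − y‖ ≤ −Re y + ρ³` (first-order Taylor bound `‖log (1 − y) + y‖ ≤ ‖y‖² / (2 (1 − ‖y‖))`
and `‖y‖² ≤ ρ⁴ ≤ ρ³/2`). -/
theorem log_norm_one_sub_le {y : ℂ} {ρ : ℝ} (hρ0 : 0 ≤ ρ) (hρ : ρ ≤ 1 / 2) (hy : ‖y‖ ≤ ρ ^ 2) :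
    Real.log ‖1 - y‖ ≤ -y.re + ρ ^ 3 := by
  have hρ2 : ρ ^ 2 ≤ 1 / 4 := by nlinarith
  have hy4 : ‖y‖ ≤ 1 / 4 := hy.trans hρ2
  have hz : ‖-y‖ < 1 := by rw [norm_neg]; linarith
  have h1 := Complex.norm_log_one_add_sub_self_le hz
  rw [norm_neg, ← sub_eq_add_neg, sub_neg_eq_add] at h1
  have h2 : Real.log ‖1 - y‖ = -y.re + (Complex.log (1 - y) + y).re := by
    rw [Complex.add_re, Complex.log_re]; ring
  have h3 : (Complex.log (1 - y) + y).re ≤ ‖y‖ ^ 2 * (1 - ‖y‖)⁻¹ / 2 :=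
    (Complex.re_le_norm _).trans h1
  have hw : (1 - ‖y‖)⁻¹ ≤ 2 := by rw [inv_le_comm₀ (by linarith) two_pos]; linarith
  have hwnn : 0 ≤ (1 - ‖y‖)⁻¹ := inv_nonneg.mpr (by linarith)
  have hρ3 : 0 ≤ ρ ^ 3 := pow_nonneg hρ0 3
  have hu2 : ‖y‖ ^ 2 ≤ ρ ^ 3 / 2 :=
    calc ‖y‖ ^ 2 ≤ (ρ ^ 2) ^ 2 := pow_le_pow_left₀ (norm_nonneg _) hy 2
      _ = ρ ^ 3 * ρ := by ring
      _ ≤ ρ ^ 3 * (1 / 2) := mul_le_mul_of_nonneg_left hρ hρ3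
      _ = ρ ^ 3 / 2 := by ring
  have h4 : ‖y‖ ^ 2 * (1 - ‖y‖)⁻¹ ≤ ρ ^ 3 / 2 * 2 := mul_le_mul hu2 hw hwnn (by linarith)
  rw [h2]
  linarith

/-- **Odd part, root by root**: for `‖x‖ ≤ ρ ≤ 1/2`,
`log ‖1 + x‖ − log ‖1 − x‖ ≤ 2 Re x + 2 ρ³` (the quadratic Taylor terms of `log (1 ± x)` cancel,
and each cubic remainder is at most `‖x‖³ / (3 (1 − ‖x‖)) ≤ (2/3) ρ³`). -/
theorem log_norm_one_add_sub_log_norm_one_sub_le {x : ℂ} {ρ : ℝ} (hρ0 : 0 ≤ ρ) (hρ : ρ ≤ 1 / 2)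
    (hx : ‖x‖ ≤ ρ) : Real.log ‖1 + x‖ - Real.log ‖1 - x‖ ≤ 2 * x.re + 2 * ρ ^ 3 := by
  have hx2 : ‖x‖ ≤ 1 / 2 := hx.trans hρ
  have hx1 : ‖x‖ < 1 := by linarith
  have hx1' : ‖-x‖ < 1 := by rwa [norm_neg]
  -- cubic Taylor bounds `‖log (1 + z) − (z − z²/2)‖ ≤ ‖z‖³ / (3 (1 − ‖z‖))` at `z = ± x`
  have hp := Literature.Probability.LatticeModels.norm_log_one_add_sub_le hx1
  have hm := Literature.Probability.LatticeModels.norm_log_one_add_sub_le hx1'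
  rw [norm_neg, neg_sq, ← sub_eq_add_neg] at hm
  have hw : (1 - ‖x‖)⁻¹ ≤ 2 := by rw [inv_le_comm₀ (by linarith) two_pos]; linarith
  have hwnn : 0 ≤ (1 - ‖x‖)⁻¹ := inv_nonneg.mpr (by linarith)
  have hρ3 : 0 ≤ ρ ^ 3 := pow_nonneg hρ0 3
  have hx3 : ‖x‖ ^ 3 ≤ ρ ^ 3 := pow_le_pow_left₀ (norm_nonneg _) hx 3
  have h4 : ‖x‖ ^ 3 * (1 - ‖x‖)⁻¹ ≤ ρ ^ 3 * 2 := mul_le_mul hx3 hw hwnn hρ3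
  have hid : Real.log ‖1 + x‖ - Real.log ‖1 - x‖ = 2 * x.re +
      ((Complex.log (1 + x) - (x - x ^ 2 / 2)) -
        (Complex.log (1 - x) - (-x - x ^ 2 / 2))).re := by
    simp only [Complex.sub_re, Complex.neg_re, Complex.log_re]; ring
  have hre := Complex.re_le_norm
    ((Complex.log (1 + x) - (x - x ^ 2 / 2)) - (Complex.log (1 - x) - (-x - x ^ 2 / 2)))
  have hns := norm_sub_le (Complex.log (1 + x) - (x - x ^ 2 / 2))
    (Complex.log (1 - x) - (-x - x ^ 2 / 2))
  rw [hid]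
  linarith

end LogDetSecondOrder

open LogDetSecondOrder in
/-- **Second-order log-determinant bound** (registered stub `stub_logDetSecondOrder` of the line
`Sketch`): for a complex square matrix `R` with `Σᵢ ‖(R v)ᵢ‖² ≤ ρ² Σᵢ ‖vᵢ‖²` (`0 ≤ ρ ≤ 1/2`),
`‖det (1 + R)‖ ≤ exp (Re tr R − ½ Re tr R² + 2 |ι| ρ³)`: the second-order expansion of
`log ‖det (1 + R)‖` in the eigenvalues with a cubic remainder. -/
theorem stub_logDetSecondOrder :
    ∀ {ι : Type} [Fintype ι] [DecidableEq ι] (R : Matrix ι ι ℂ) (ρ : ℝ), 0 ≤ ρ → ρ ≤ 1 / 2 →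
      (∀ v : ι → ℂ, ∑ i, ‖(R.mulVec v) i‖ ^ 2 ≤ ρ ^ 2 * ∑ i, ‖v i‖ ^ 2) →
      ‖(1 + R).det‖ ≤ Real.exp (R.trace.re - (R * R).trace.re / 2 + 2 * Fintype.card ι * ρ ^ 3) := by
  intro ι _ _ R ρ hρ0 hρ hR
  have hρ3 : 0 ≤ ρ ^ 3 := pow_nonneg hρ0 3
  have hρ1 : ρ < 1 := by linarith
  have hρ21 : ρ ^ 2 < 1 := by nlinarith
  -- the operator bound for `R * R`
  have hRR : ∀ v : ι → ℂ, ∑ i, ‖((R * R).mulVec v) i‖ ^ 2 ≤ (ρ ^ 2) ^ 2 * ∑ i, ‖v i‖ ^ 2 := by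
    intro v
    rw [← Matrix.mulVec_mulVec]
    calc ∑ i, ‖(R.mulVec (R.mulVec v)) i‖ ^ 2 ≤ ρ ^ 2 * ∑ i, ‖(R.mulVec v) i‖ ^ 2 := hR _
      _ ≤ ρ ^ 2 * (ρ ^ 2 * ∑ i, ‖v i‖ ^ 2) := mul_le_mul_of_nonneg_left (hR v) (sq_nonneg _)
      _ = (ρ ^ 2) ^ 2 * ∑ i, ‖v i‖ ^ 2 := by ring
  -- eigenvalue bounds
  have hs : ∀ x : R.charpoly.roots, ‖(x : ℂ)‖ ≤ ρ := fun x =>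
    norm_root_charpoly_le R hρ0 hR Multiset.coe_mem
  have ht : ∀ y : (R * R).charpoly.roots, ‖(y : ℂ)‖ ≤ ρ ^ 2 := fun y =>
    norm_root_charpoly_le (R * R) (sq_nonneg ρ) hRR Multiset.coe_mem
  have hp_pos : ∀ x : R.charpoly.roots, 0 < ‖1 + (x : ℂ)‖ := fun x =>
    norm_one_add_pos ((hs x).trans_lt hρ1)
  have hm_pos : ∀ x : R.charpoly.roots, 0 < ‖1 - (x : ℂ)‖ := fun x =>
    norm_one_sub_pos ((hs x).trans_lt hρ1)
  have ht_pos : ∀ y : (R * R).charpoly.roots, 0 < ‖1 - (y : ℂ)‖ := fun y =>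
    norm_one_sub_pos ((ht y).trans_lt hρ21)
  -- the three determinants as products over roots, and their logarithms
  have ha : 0 < ‖(1 + R).det‖ := by
    rw [det_one_add_eq_prod_coe, norm_prod]
    exact Finset.prod_pos fun x _ => hp_pos x
  have hb : 0 < ‖(1 - R).det‖ := by
    rw [det_one_sub_eq_prod_coe, norm_prod]
    exact Finset.prod_pos fun x _ => hm_pos x
  have hlog_p : Real.log ‖(1 + R).det‖ = ∑ x : R.charpoly.roots, Real.log ‖1 + (x : ℂ)‖ := by
    rw [det_one_add_eq_prod_coe, norm_prod, Real.log_prod fun x _ => (hp_pos x).ne']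
  have hlog_m : Real.log ‖(1 - R).det‖ = ∑ x : R.charpoly.roots, Real.log ‖1 - (x : ℂ)‖ := by
    rw [det_one_sub_eq_prod_coe, norm_prod, Real.log_prod fun x _ => (hm_pos x).ne']
  have hlog_t : Real.log ‖(1 - R * R).det‖ =
      ∑ y : (R * R).charpoly.roots, Real.log ‖1 - (y : ℂ)‖ := by
    rw [det_one_sub_eq_prod_coe, norm_prod, Real.log_prod fun y _ => (ht_pos y).ne']
  -- `(1 + R)(1 - R) = 1 - R²`, so `2 log a = log ‖det (1 - R²)‖ + (log a - log b)`
  have hmul : ‖(1 + R).det‖ * ‖(1 - R).det‖ = ‖(1 - R * R).det‖ := by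
    rw [← norm_mul, ← Matrix.det_mul]
    congr 2
    noncomm_ring
  have hkey : 2 * Real.log ‖(1 + R).det‖ = Real.log ‖(1 - R * R).det‖ +
      (Real.log ‖(1 + R).det‖ - Real.log ‖(1 - R).det‖) := by
    rw [← hmul, Real.log_mul ha.ne' hb.ne']
    ring
  -- even part
  have heven : Real.log ‖(1 - R * R).det‖ ≤ -(R * R).trace.re + Fintype.card ι * ρ ^ 3 := by
    rw [hlog_t, trace_re_eq_sum_coe (R * R), ← card_roots_charpoly (R * R)]
    calc ∑ y : (R * R).charpoly.roots, Real.log ‖1 - (y : ℂ)‖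
        ≤ ∑ y : (R * R).charpoly.roots, (-(y : ℂ).re + ρ ^ 3) :=
          Finset.sum_le_sum fun y _ => log_norm_one_sub_le hρ0 hρ (ht y)
      _ = -∑ y : (R * R).charpoly.roots, (y : ℂ).re
            + Fintype.card ((R * R).charpoly.roots) * ρ ^ 3 := by
          rw [Finset.sum_add_distrib, Finset.sum_neg_distrib, Finset.sum_const, nsmul_eq_mul,
            Finset.card_univ]
  -- odd part
  have hodd : Real.log ‖(1 + R).det‖ - Real.log ‖(1 - R).det‖ ≤
      2 * R.trace.re + 2 * (Fintype.card ι * ρ ^ 3) := by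
    rw [hlog_p, hlog_m, ← Finset.sum_sub_distrib, trace_re_eq_sum_coe R, ← card_roots_charpoly R]
    calc ∑ x : R.charpoly.roots, (Real.log ‖1 + (x : ℂ)‖ - Real.log ‖1 - (x : ℂ)‖)
        ≤ ∑ x : R.charpoly.roots, (2 * (x : ℂ).re + 2 * ρ ^ 3) :=
          Finset.sum_le_sum fun x _ => log_norm_one_add_sub_log_norm_one_sub_le hρ0 hρ (hs x)
      _ = 2 * ∑ x : R.charpoly.roots, (x : ℂ).re
            + 2 * (Fintype.card (R.charpoly.roots) * ρ ^ 3) := by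
          rw [Finset.sum_add_distrib, ← Finset.mul_sum, Finset.sum_const, nsmul_eq_mul,
            Finset.card_univ]
          ring
  -- combine and exponentiate
  have hn : 0 ≤ (Fintype.card ι : ℝ) * ρ ^ 3 := mul_nonneg (Nat.cast_nonneg _) hρ3
  have hlog : Real.log ‖(1 + R).det‖ ≤
      R.trace.re - (R * R).trace.re / 2 + 2 * Fintype.card ι * ρ ^ 3 := by
    have h2 : (2 : ℝ) * Fintype.card ι * ρ ^ 3 = 2 * (Fintype.card ι * ρ ^ 3) := mul_assoc _ _ _
    rw [h2]
    linarith
  calc ‖(1 + R).det‖ = Real.exp (Real.log ‖(1 + R).det‖) := (Real.exp_log ha).symm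
    _ ≤ _ := Real.exp_le_exp.mpr hlog

end Summit.QuantumFields.QCD.Cruxes.CriticalLineDiamagnetism.ChessboardCellGain

end
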